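import Summits.BirchSwinnertonDyer.BirchSwinnertonDyer.Theses.PrintX6
import Summits.BirchSwinnertonDyer.Rank1Residual.Supersingular.X6RankZeroLeafResidual
import Summits.BirchSwinnertonDyer.BirchSwinnertonDyer.Theses.SignedLowerHalves
import HarnessLib

/-!
# Route `PrintX6` — residual links by name, part 2: over `PublishedInputsX6`, each crux IS its registered stub,
# IS its slice of the leaf, and IS Kobayashi's main conjecture on that slice
# (cell `bsd-print-x6`, prover seat p2 gen 2; `--supports stmt-BirchSwinnertonDyer-20276 --as helper`; THEOREMS ONLY;
# closes nothing)

HONEST FRAMING (run/shared/lean/pub/bsd-print-x6/README.md; PRINT tier D-0131 (2); PARTITION currency: leaf A6 =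
`ClassX6 ∧ r_an = 0`, rung W-ALL/6 `Summit.BirchSwinnertonDyer.WAllCornerX6r0`). After `UpperHalfX6` (p535414),
`Assembly` (p535696) and the inputs glue (p537101) the route `PrintX6` is exactly its two Eisenstein cruxes
`EisensteinHalfFiveLe` (stmt-BirchSwinnertonDyer-20276; registered stub 1 `stub_signedLowerDivisibilityFiveLe`, stub 2
landed p541769) and `EisensteinHalfAtThree` (stmt-…-20285). Typer seat ty2 handed the prover seats a by-name TURNKEY
(`HOME/ty2/PrintX6ResidualLinks.lean`); its §A/§C landed in seat p1's `Theorems/PrintX6BSTWByName.lean` (p541401).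
THIS FILE lands the remainder (§B) and adds the prime-sliced equivalences (§E), importing NO other `Theorems/PrintX6*`
module (theses-cone hygiene: only the route file and ty2's route-independent tranches `X6RankZeroLeaf{Hypotheses,
Target,Residual}` are imported). Everything is over the route's input conjunction `PublishedInputsX6` (nine REFEREED
named facts, by name; the Wuthrich-Lemma-20 conjunct is never used — it is a tree theorem anyway):

* §B (ty2 turnkey) pair level `BSD(E,p) ⟺ Kobayashi MC (either sign) ⟺ one-sign Eisenstein divisibility` at every odd
  X6 pair with `r_an = 0`, and class level `WAllCornerX6r0 ⟺ MC (both signs) ⟺ one-sign divisibility` on the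
  rank-zero slice — ty2 tranche 3 (p539993) with the input conjunction destructured.
* §E (new, p2) the PRIME-SLICED form the route actually files: over the inputs, crux `EisensteinHalfFiveLe` ⟺ the
  `p ≥ 5` slice of the leaf (`BSD(E,p)` at every non-CM X6 pair with `p ≥ 5`, `r_an = 0`) ⟺ its registered stub 1
  `stub_signedLowerDivisibilityFiveLe` (signature verbatim) ⟺ Kobayashi MC (both signs) on that slice; the `p = 3`
  twins for the residual crux `EisensteinHalfAtThree`. So the birth skeletons (planner g1, rev 2) LOSE NOTHING: stub 1
  is not merely sufficient but equivalent to its crux, and each crux is exactly its prime slice of rung W-ALL/6 — the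
  value-cell restriction «`ord_p q ≠ 0`» and the `¬CM` binder are decoration (vet Mutation.lean agrees), because the
  route's PROVED upper half closes the unit cells and `ClassX6.not_hasCM`.

Mechanism of ⟹ in §E: the crux at a pair + the upper half from the inputs
(`X6RankZero.missingUpperBoundAt_of_inputs` = p2's `X6.missingUpperBoundAt_rankZero_of_thm41`: Kobayashi Thm. 4.1 (b)
with the `p`-adic tower onto, Thm. 1.2, Kim Cor. 3.15, period units, modularity) ⟹ `MissingPPartAt`
(`missingPPartAt_of_upper_of_nonUnit`) ⟹ `BSD(E,p)` (`bsdp_of_missingPPartAt`, GZK) ⟹ Kobayashi MC both signs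
(`X6RankZero.kobayashiMainConjecture_of_inputs_of_bsdp`, the tree's converse descent) ⟹ one-sign divisibility.

* §A(ii) (appended, PLAN v3 § p2-g2): the route header's clause «PrintX6 is mooted if SignedLowerHalves closes
  `KobayashiLowerHalfSemistable`» in kernel form WITHOUT the `UpperHalfX6` binder — `PublishedInputsX6` and cell
  bsd-ssimc's crux stmt-BirchSwinnertonDyer-19000 (its `def`, by name) give the rung (p1's
  `wallCornerX6r0_of_printX6_kobayashiLowerHalfSemistable` carries `hU : UpperHalfX6` as a binder; here the upper
  half comes from the inputs through ty2 tranche 3). The only import added is K3's route file `Theses.SignedLowerHalves`.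

0 `def`, 0 named fact, debt 0; CONDITIONAL statements only (inputs / the OPEN crux 19000); nothing about any curve is asserted;
beyond-print theorem: NO; PARTITION: 0 cells.

References: [Kobayashi2003] Thm. 1.2, Thm. 4.1, (3.6), Conjecture (p. 2); [BDKim2013] Cor. 3.15; [Pollack2003] Thm. 5.6;
[GreenbergVatsal2000] Rem. 3.4; [Miller2011LMS] Def. 1.1; HOME/PLAN.md v2; HOME/ty2/PrintX6ResidualLinks.lean (ty2 g1).
-/

set_option autoImplicit false
-- the landed namespace `Summit.BirchSwinnertonDyer.BirchSwinnertonDyer.Theorems` (summit = problem) trips the linter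
set_option linter.dupNamespace false

noncomputable section

open scoped Classical

open WeierstrassCurve Literature.NumberTheory.EllipticCurves
  Literature.NumberTheory.EllipticCurves.ModularForms
  Literature.NumberTheory.EllipticCurves.Rank1Residual
  Literature.NumberTheory.EllipticCurves.Rank1Residual.Typed
  Literature.NumberTheory.EllipticCurves.Kobayashi2003
  Summit.BirchSwinnertonDyer.Rank1Residual.Supersingular
  Summit.BirchSwinnertonDyer.BirchSwinnertonDyer.Theses.PrintX6

namespace Summit.BirchSwinnertonDyer.BirchSwinnertonDyer.Theorems.PrintX6

/-! ### §B Over `PublishedInputsX6`: leaf currency ⟺ Kobayashi currency (ty2 turnkey remainder) -/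

section PairLevel

variable (W : WeierstrassCurve ℚ) [W.IsElliptic] [W.IsGloballyMinimal] (p : ℕ) [Fact p.Prime]

/-- **Pair level: over `PublishedInputsX6`, `BSD(E,p)` at an odd X6 pair with `r_an = 0` IS Kobayashi's main
conjecture there (either sign)** — `X6RankZero.bsdp_iff_kobayashiMainConjecture` with the input conjunction
destructured (⟸: Kato-side Thm. 4.1 + the Eisenstein half of the MC + Kim Cor. 3.15 descent; ⟹: the tree's converse
descent `X6.kobayashiMainConjecture_of_bsdp_of_analyticRank_eq_zero`). CONDITIONAL on the inputs; closes nothing.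
[cite: Kobayashi2003, Thm. 1.2 (p. 2), Thm. 4.1 (p. 8) and Conjecture (p. 2)] [cite: BDKim2013, Cor. 3.15 (p. 199)]
[cite: GreenbergVatsal2000, Rem. 3.4] [cite: Miller2011LMS, Def. 1.1] -/
theorem X6.bsdp_iff_kobayashiMainConjecture_of_publishedInputsX6 (hPub : PublishedInputsX6) (hp : p ≠ 2)
    (hX : ClassX6 W p) (h0 : W.analyticRank = 0) (ε : ℤˣ) : BSDp W p ↔ KobayashiMainConjecture W p ε := by
  obtain ⟨h12, h41, hKim, h5, h3, -, hmodP, hmod, hGZK⟩ := hPub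
  exact X6RankZero.bsdp_iff_kobayashiMainConjecture W p h12 h41 hKim h5 h3 hmodP hmod hGZK hp hX h0 ε

/-- **Pair level: over `PublishedInputsX6`, `BSD(E,p)` at an odd X6 pair with `r_an = 0` IS the one-sign Eisenstein
divisibility `KobayashiLowerDivisibility W p ε` (either sign)** — `X6RankZero.bsdp_iff_kobayashiLowerDivisibility`
with the input conjunction destructured. CONDITIONAL on the inputs; closes nothing.
[cite: Kobayashi2003, Thm. 1.2 (p. 2), Thm. 4.1 (p. 8) and Conjecture (p. 2)] [cite: BDKim2013, Cor. 3.15 (p. 199)]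
[cite: GreenbergVatsal2000, Rem. 3.4] [cite: Miller2011LMS, Def. 1.1] -/
theorem X6.bsdp_iff_kobayashiLowerDivisibility_of_publishedInputsX6 (hPub : PublishedInputsX6) (hp : p ≠ 2)
    (hX : ClassX6 W p) (h0 : W.analyticRank = 0) (ε : ℤˣ) : BSDp W p ↔ KobayashiLowerDivisibility W p ε := by
  obtain ⟨h12, h41, hKim, h5, h3, -, hmodP, hmod, hGZK⟩ := hPub
  exact X6RankZero.bsdp_iff_kobayashiLowerDivisibility W p h12 h41 hKim h5 h3 hmodP hmod hGZK hp hX h0 ε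

/-- **Pair level: over `PublishedInputsX6`, a crux's CONCLUSION at one odd X6 pair with `r_an = 0` (the valuation
inequality on the non-unit cell, verbatim the cruxes' body at `(W, p)`) already gives `BSD(E,p)` there** — the
route's PROVED upper half (`X6RankZero.missingUpperBoundAt_of_inputs`) closes the unit cell and supplies the other
inequality (`missingPPartAt_of_upper_of_nonUnit`, `bsdp_of_missingPPartAt` with GZK). The pair-level form of the
route's Assembly. CONDITIONAL on the inputs. [cite: Kobayashi2003, Thm. 1.2 (p. 2), Thm. 4.1 (p. 8)]
[cite: BDKim2013, Cor. 3.15 (p. 199)] [cite: GreenbergVatsal2000, Rem. 3.4] [cite: Miller2011LMS, §1 and Def. 1.1] -/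
theorem X6.bsdp_of_publishedInputsX6_of_eisensteinHalf_cell (hPub : PublishedInputsX6) (hp : p ≠ 2)
    (hX : ClassX6 W p) (h0 : W.analyticRank = 0)
    (hcell : ∀ q : ℚ, shaAn W = (q : ℂ) → padicValRat p q ≠ 0 → padicValRat p q ≤ (padicValNat p W.shaOrder : ℤ)) :
    BSDp W p := by
  obtain ⟨h12, h41, hKim, h5, h3, -, hmodP, hmod, hGZK⟩ := hPub
  exact bsdp_of_missingPPartAt W p hGZK (by omega)
    (missingPPartAt_of_upper_of_nonUnit W p
      (X6RankZero.missingUpperBoundAt_of_inputs W p h12 h41 hKim h5 h3 hmodP hmod hGZK hp hX h0) hcell)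

omit [W.IsGloballyMinimal] in
/-- **Pair level, converse: `BSD(E,p)` at an X6 pair with `r_an = 0` gives the crux's conclusion there** (GZK only:
`X6RankZero.missingLowerBoundAt_of_bsdp`, then the value of `#Ш_an` is unique). [cite: Miller2011LMS, Def. 1.1] -/
theorem X6.eisensteinHalf_cell_of_bsdp (hGZK : rank_eq_analyticRank_of_analyticRank_le_one)
    (h0 : W.analyticRank = 0) (hB : BSDp W p) :
    ∀ q : ℚ, shaAn W = (q : ℂ) → padicValRat p q ≠ 0 → padicValRat p q ≤ (padicValNat p W.shaOrder : ℤ) :=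
  fun q hq _ ↦ padicValRat_le_of_missingLowerBoundAt W p (X6RankZero.missingLowerBoundAt_of_bsdp W p hGZK h0 hB) q hq

end PairLevel

/-- **Class level: over `PublishedInputsX6` the rung W-ALL/6 IS Kobayashi's ± main conjecture (both signs) on the
rank-zero slice of X6** (`X6RankZero.wallCornerX6r0_iff_forall_kobayashiMainConjecture`, input conjunction
destructured). CONDITIONAL on the inputs; closes nothing.
[cite: Kobayashi2003, Thm. 1.2 (p. 2), Thm. 4.1 (p. 8) and Conjecture (p. 2)] [cite: BDKim2013, Cor. 3.15 (p. 199)]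
[cite: GreenbergVatsal2000, Rem. 3.4] [cite: Miller2011LMS, Def. 1.1] -/
theorem wallCornerX6r0_iff_forall_kobayashiMainConjecture_of_publishedInputsX6 (hPub : PublishedInputsX6) :
    WAllCornerX6r0 ↔
      ∀ (W : WeierstrassCurve ℚ) [W.IsElliptic] [W.IsGloballyMinimal] (p : ℕ) [Fact p.Prime],
        p ≠ 2 → ClassX6 W p → W.analyticRank = 0 → ∀ ε : ℤˣ, KobayashiMainConjecture W p ε := by
  obtain ⟨h12, h41, hKim, h5, h3, -, hmodP, hmod, hGZK⟩ := hPub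
  exact X6RankZero.wallCornerX6r0_iff_forall_kobayashiMainConjecture h12 h41 hKim h5 h3 hmodP hmod hGZK

/-- **Class level: over `PublishedInputsX6` the rung W-ALL/6 IS the one-sign Eisenstein divisibility on the rank-zero
slice of X6** — the `r_an = 0` restriction of the body of cell bsd-ssimc's crux `KobayashiLowerHalfSemistable`
(stmt-BirchSwinnertonDyer-19000); `X6RankZero.wallCornerX6r0_iff_forall_exists_kobayashiLowerDivisibility`, input
conjunction destructured. On the leaf the weakest (one sign, `r_an = 0`) and the strongest (both signs) forms of the
residual coincide. CONDITIONAL on the inputs; closes nothing.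
[cite: Kobayashi2003, Thm. 1.2 (p. 2), Thm. 4.1 (p. 8) and Conjecture (p. 2)] [cite: BDKim2013, Cor. 3.15 (p. 199)]
[cite: GreenbergVatsal2000, Rem. 3.4] [cite: Miller2011LMS, Def. 1.1] -/
theorem wallCornerX6r0_iff_forall_exists_kobayashiLowerDivisibility_of_publishedInputsX6 (hPub : PublishedInputsX6) :
    WAllCornerX6r0 ↔
      ∀ (W : WeierstrassCurve ℚ) [W.IsElliptic] [W.IsGloballyMinimal] (p : ℕ) [Fact p.Prime],
        p ≠ 2 → ClassX6 W p → W.analyticRank = 0 → ∃ ε : ℤˣ, KobayashiLowerDivisibility W p ε := by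
  obtain ⟨h12, h41, hKim, h5, h3, -, hmodP, hmod, hGZK⟩ := hPub
  exact X6RankZero.wallCornerX6r0_iff_forall_exists_kobayashiLowerDivisibility h12 h41 hKim h5 h3 hmodP hmod hGZK

/-! ### §E The prime-sliced equivalences: each crux = its slice of the leaf = its stub 1 = MC on its slice -/

/-- **Crux `EisensteinHalfFiveLe` (stmt-20276) IS the `p ≥ 5` slice of the leaf, over `PublishedInputsX6`**:
`BSD(E,p)` at every non-CM X6 pair with `p ≥ 5` and `r_an = 0`. (⟹ pair by pair through the proved upper half,
`X6.bsdp_of_publishedInputsX6_of_eisensteinHalf_cell`; ⟸ by GZK, `X6.eisensteinHalf_cell_of_bsdp`.) So the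
non-unit-cell restriction in the crux is decoration. CONDITIONAL on the inputs; closes nothing.
[cite: Kobayashi2003, Thm. 1.2 (p. 2), Thm. 4.1 (p. 8)] [cite: BDKim2013, Cor. 3.15 (p. 199)]
[cite: GreenbergVatsal2000, Rem. 3.4] [cite: Miller2011LMS, Def. 1.1] -/
theorem eisensteinHalfFiveLe_iff_forall_bsdp_of_publishedInputsX6 (hPub : PublishedInputsX6) :
    EisensteinHalfFiveLe ↔
      ∀ (W : WeierstrassCurve ℚ) [W.IsElliptic] [W.IsGloballyMinimal] (p : ℕ) [Fact p.Prime],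
        ¬ W.HasCM → 5 ≤ p → ClassX6 W p → W.analyticRank = 0 → BSDp W p := by
  refine ⟨fun hE W _ _ p _ hcm h5p hX h0 ↦ ?_, fun hB W _ _ p _ hcm h5p hX h0 ↦ ?_⟩
  · exact X6.bsdp_of_publishedInputsX6_of_eisensteinHalf_cell W p hPub (by omega) hX h0 (hE W p hcm h5p hX h0)
  · exact X6.eisensteinHalf_cell_of_bsdp W p hPub.2.2.2.2.2.2.2.2 h0 (hB W p hcm h5p hX h0)

/-- **Residual crux `EisensteinHalfAtThree` (stmt-20285) IS the `p = 3` slice of the leaf, over `PublishedInputsX6`.**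
CONDITIONAL on the inputs; closes nothing. [cite: Kobayashi2003, Thm. 1.2 (p. 2), Thm. 4.1 (p. 8)]
[cite: BDKim2013, Cor. 3.15 (p. 199)] [cite: GreenbergVatsal2000, Rem. 3.4] [cite: Miller2011LMS, Def. 1.1] -/
theorem eisensteinHalfAtThree_iff_forall_bsdp_of_publishedInputsX6 (hPub : PublishedInputsX6) :
    EisensteinHalfAtThree ↔
      ∀ (W : WeierstrassCurve ℚ) [W.IsElliptic] [W.IsGloballyMinimal] (p : ℕ) [Fact p.Prime],
        ¬ W.HasCM → p = 3 → ClassX6 W p → W.analyticRank = 0 → BSDp W p := by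
  refine ⟨fun hE W _ _ p _ hcm h3p hX h0 ↦ ?_, fun hB W _ _ p _ hcm h3p hX h0 ↦ ?_⟩
  · exact X6.bsdp_of_publishedInputsX6_of_eisensteinHalf_cell W p hPub (by omega) hX h0 (hE W p hcm h3p hX h0)
  · exact X6.eisensteinHalf_cell_of_bsdp W p hPub.2.2.2.2.2.2.2.2 h0 (hB W p hcm h3p hX h0)

/-- **Crux `EisensteinHalfFiveLe` IS its registered stub 1, over `PublishedInputsX6`** — the right-hand side is
VERBATIM the signature of `stub_signedLowerDivisibilityFiveLe` (birth skeleton rev 2 on 20276, sha 64f82d60…; = the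
`¬CM, 5 ≤ p, r_an = 0` restriction of stmt-BirchSwinnertonDyer-19000): the skeleton loses nothing. (⟸ is the
skeleton's composition / p4's `eisensteinHalfFiveLe_of_inputs_of_signedLowerDivisibilityFiveLe`; ⟹ is new: crux ⟹
`BSD(E,p)` on the slice ⟹ Kobayashi MC ⟹ divisibility, sign `1`.) CONDITIONAL on the inputs; closes nothing.
[cite: Kobayashi2003, Thm. 1.2 (p. 2), Thm. 4.1 (p. 8) and Conjecture (p. 2)] [cite: BDKim2013, Cor. 3.15 (p. 199)]
[cite: GreenbergVatsal2000, Rem. 3.4] [cite: Miller2011LMS, Def. 1.1] -/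
theorem eisensteinHalfFiveLe_iff_stub_of_publishedInputsX6 (hPub : PublishedInputsX6) :
    EisensteinHalfFiveLe ↔
      ∀ (W : WeierstrassCurve ℚ) [W.IsElliptic] [W.IsGloballyMinimal] (p : ℕ) [Fact p.Prime], ¬ W.HasCM → 5 ≤ p →
        Literature.NumberTheory.EllipticCurves.Rank1Residual.ClassX6 W p → W.analyticRank = 0 →
        ∃ ε : ℤˣ, Summit.BirchSwinnertonDyer.Rank1Residual.Supersingular.KobayashiLowerDivisibility W p ε := by
  rw [eisensteinHalfFiveLe_iff_forall_bsdp_of_publishedInputsX6 hPub]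
  refine ⟨fun hB W _ _ p _ hcm h5p hX h0 ↦ ⟨1, ?_⟩, fun hS W _ _ p _ hcm h5p hX h0 ↦ ?_⟩
  · exact (X6.bsdp_iff_kobayashiLowerDivisibility_of_publishedInputsX6 W p hPub (by omega) hX h0 1).1
      (hB W p hcm h5p hX h0)
  · obtain ⟨ε, hε⟩ := hS W p hcm h5p hX h0
    exact (X6.bsdp_iff_kobayashiLowerDivisibility_of_publishedInputsX6 W p hPub (by omega) hX h0 ε).2 hε

/-- **Residual crux `EisensteinHalfAtThree` IS its registered stub 1, over `PublishedInputsX6`** — right-hand side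
VERBATIM the signature of `stub_signedLowerDivisibilityAtThree` (birth skeleton rev 2 on 20285, sha 5dafa6f9…).
CONDITIONAL on the inputs; closes nothing. [cite: Kobayashi2003, Thm. 1.2 (p. 2), Thm. 4.1 (p. 8) and Conjecture (p. 2)]
[cite: BDKim2013, Cor. 3.15 (p. 199)] [cite: GreenbergVatsal2000, Rem. 3.4] [cite: Miller2011LMS, Def. 1.1] -/
theorem eisensteinHalfAtThree_iff_stub_of_publishedInputsX6 (hPub : PublishedInputsX6) :
    EisensteinHalfAtThree ↔
      ∀ (W : WeierstrassCurve ℚ) [W.IsElliptic] [W.IsGloballyMinimal] (p : ℕ) [Fact p.Prime], ¬ W.HasCM → p = 3 →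
        Literature.NumberTheory.EllipticCurves.Rank1Residual.ClassX6 W p → W.analyticRank = 0 →
        ∃ ε : ℤˣ, Summit.BirchSwinnertonDyer.Rank1Residual.Supersingular.KobayashiLowerDivisibility W p ε := by
  rw [eisensteinHalfAtThree_iff_forall_bsdp_of_publishedInputsX6 hPub]
  refine ⟨fun hB W _ _ p _ hcm h3p hX h0 ↦ ⟨1, ?_⟩, fun hS W _ _ p _ hcm h3p hX h0 ↦ ?_⟩
  · exact (X6.bsdp_iff_kobayashiLowerDivisibility_of_publishedInputsX6 W p hPub (by omega) hX h0 1).1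
      (hB W p hcm h3p hX h0)
  · obtain ⟨ε, hε⟩ := hS W p hcm h3p hX h0
    exact (X6.bsdp_iff_kobayashiLowerDivisibility_of_publishedInputsX6 W p hPub (by omega) hX h0 ε).2 hε

/-- **Crux `EisensteinHalfFiveLe` IS Kobayashi's ± main conjecture (both signs) on the `p ≥ 5` rank-zero slice of X6,
over `PublishedInputsX6`.** CONDITIONAL on the inputs; closes nothing.
[cite: Kobayashi2003, Thm. 1.2 (p. 2), Thm. 4.1 (p. 8) and Conjecture (p. 2)] [cite: BDKim2013, Cor. 3.15 (p. 199)]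
[cite: GreenbergVatsal2000, Rem. 3.4] [cite: Miller2011LMS, Def. 1.1] -/
theorem eisensteinHalfFiveLe_iff_forall_kobayashiMainConjecture_of_publishedInputsX6 (hPub : PublishedInputsX6) :
    EisensteinHalfFiveLe ↔
      ∀ (W : WeierstrassCurve ℚ) [W.IsElliptic] [W.IsGloballyMinimal] (p : ℕ) [Fact p.Prime], ¬ W.HasCM → 5 ≤ p →
        ClassX6 W p → W.analyticRank = 0 → ∀ ε : ℤˣ, KobayashiMainConjecture W p ε := by
  rw [eisensteinHalfFiveLe_iff_forall_bsdp_of_publishedInputsX6 hPub]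
  refine ⟨fun hB W _ _ p _ hcm h5p hX h0 ε ↦ ?_, fun hM W _ _ p _ hcm h5p hX h0 ↦ ?_⟩
  · exact (X6.bsdp_iff_kobayashiMainConjecture_of_publishedInputsX6 W p hPub (by omega) hX h0 ε).1
      (hB W p hcm h5p hX h0)
  · exact (X6.bsdp_iff_kobayashiMainConjecture_of_publishedInputsX6 W p hPub (by omega) hX h0 1).2
      (hM W p hcm h5p hX h0 1)

/-- **Residual crux `EisensteinHalfAtThree` IS Kobayashi's ± main conjecture (both signs) on the `p = 3` (`a₃ = 0`)
rank-zero slice of X6, over `PublishedInputsX6`.** CONDITIONAL on the inputs; closes nothing.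
[cite: Kobayashi2003, Thm. 1.2 (p. 2), Thm. 4.1 (p. 8) and Conjecture (p. 2)] [cite: BDKim2013, Cor. 3.15 (p. 199)]
[cite: GreenbergVatsal2000, Rem. 3.4] [cite: Miller2011LMS, Def. 1.1] -/
theorem eisensteinHalfAtThree_iff_forall_kobayashiMainConjecture_of_publishedInputsX6 (hPub : PublishedInputsX6) :
    EisensteinHalfAtThree ↔
      ∀ (W : WeierstrassCurve ℚ) [W.IsElliptic] [W.IsGloballyMinimal] (p : ℕ) [Fact p.Prime], ¬ W.HasCM → p = 3 →
        ClassX6 W p → W.analyticRank = 0 → ∀ ε : ℤˣ, KobayashiMainConjecture W p ε := by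
  rw [eisensteinHalfAtThree_iff_forall_bsdp_of_publishedInputsX6 hPub]
  refine ⟨fun hB W _ _ p _ hcm h3p hX h0 ε ↦ ?_, fun hM W _ _ p _ hcm h3p hX h0 ↦ ?_⟩
  · exact (X6.bsdp_iff_kobayashiMainConjecture_of_publishedInputsX6 W p hPub (by omega) hX h0 ε).1
      (hB W p hcm h3p hX h0)
  · exact (X6.bsdp_iff_kobayashiMainConjecture_of_publishedInputsX6 W p hPub (by omega) hX h0 1).2
      (hM W p hcm h3p hX h0 1)

/-! ### §A(ii) «PrintX6 is mooted if SignedLowerHalves closes 19000» — kernel form, no `UpperHalfX6` binder -/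

/-- **The rung W-ALL/6 from `PublishedInputsX6` and cell bsd-ssimc's crux `KobayashiLowerHalfSemistable`
(stmt-BirchSwinnertonDyer-19000, its `def` consumed as is) BY NAME, Wuthrich-free and WITHOUT an `UpperHalfX6`
binder** (the upper half is derived from the inputs: `X6RankZero.wallCornerX6r0_of_inputs_of_forall_kobayashiLowerDivisibility`,
ty2 tranche 3). CONDITIONAL on 19000 (OPEN) and the inputs; closes nothing. [cite: Kobayashi2003, Thm. 1.2 (p. 2), Thm. 4.1 (p. 8) and Conjecture (p. 2)]
[cite: BDKim2013, Cor. 3.15 (p. 199)] [cite: GreenbergVatsal2000, Rem. 3.4] [cite: Miller2011LMS, §1 and Def. 1.1] -/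
theorem wallCornerX6r0_of_publishedInputsX6_of_kobayashiLowerHalfSemistable (hPub : PublishedInputsX6)
    (h19 : Summit.BirchSwinnertonDyer.BirchSwinnertonDyer.Theses.SignedLowerHalves.KobayashiLowerHalfSemistable) :
    WAllCornerX6r0 := by
  obtain ⟨h12, h41, hKim, h5, h3, -, hmodP, hmod, hGZK⟩ := hPub
  exact X6RankZero.wallCornerX6r0_of_inputs_of_forall_kobayashiLowerDivisibility h12 h41 hKim h5 h3 hmodP hmod
    hGZK h19

/-- **Both cruxes at once from `PublishedInputsX6` and stmt-19000 BY NAME, through §E** (E₅ ⟺ stub 1, E₃ ⟺ stub 1):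
the registered stubs are the `¬CM`, `r_an = 0`, `5 ≤ p` / `p = 3` restrictions of 19000's `def`. Same content as p1's
`eisensteinHalves_of_kobayashiLowerHalfSemistable` (binder order `(h) (hPub)` there), obtained here from the iff's.
CONDITIONAL on 19000 (OPEN) and the inputs; closes nothing. [cite: Kobayashi2003, Thm. 1.2 and Conjecture (p. 2)]
[cite: BDKim2013, Cor. 3.15 (p. 199)] [cite: Miller2011LMS, Def. 1.1] -/
theorem eisensteinHalves_of_publishedInputsX6_of_kobayashiLowerHalfSemistable (hPub : PublishedInputsX6)
    (h19 : Summit.BirchSwinnertonDyer.BirchSwinnertonDyer.Theses.SignedLowerHalves.KobayashiLowerHalfSemistable) :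
    EisensteinHalfFiveLe ∧ EisensteinHalfAtThree :=
  ⟨(eisensteinHalfFiveLe_iff_stub_of_publishedInputsX6 hPub).2 fun W _ _ p _ _ h5 hX _ ↦ h19 W p (by omega) hX,
    (eisensteinHalfAtThree_iff_stub_of_publishedInputsX6 hPub).2 fun W _ _ p _ _ h3 hX _ ↦ h19 W p (by omega) hX⟩

end Summit.BirchSwinnertonDyer.BirchSwinnertonDyer.Theorems.PrintX6

end
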